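import Literature.Probability.Percolation.PercolationEvents
import Literature.Probability.Percolation.Percolation
import HarnessLib

/-!
# A fair edge-by-edge exploration of an open cluster (Hutchcroft 2021, proof of Prop. 3.2)

Topic `Literature/Probability/Percolation`. Combinatorial core of the exploration martingale in the
proof of the two-ghost inequality (T. Hutchcroft, *Power-law bounds for critical long-range
percolation below the upper-critical dimension*, PTRF 181 (2021), arXiv:2008.11197, §3, proof of
Prop. 3.2: "we can condition on the environment and explore the cluster `K` one edge at a time in
such a way that ... `{E_i : 1 ≤ i ≤ T} = E(K)`"), toward the named fact
`Hutchcroft2022_twoPoint_volumeTail`. On a graph with vertex set `V` in which EVERY pair may be an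
edge (long-range models), a vertex touches infinitely many pairs, so the exploration never halts and
its correctness is a *fairness* statement: with respect to a fixed enumeration `ι` of the pairs,
querying at each step the least unqueried pair touching the currently discovered part of the cluster,

* the transcript after `n` steps is determined by the answers received (`explore_congr`,
  `setOf_explore_eq` — the event "the transcript is `l`" is a cylinder on the queried pairs);
* every queried pair is fresh (`next_not_mem_queried`) and touches the cluster of the root
  (`exists_mem_openCluster_of_mem_queried`);
* **fairness** (`exists_mem_queried_of_touches`): every pair touching the open cluster of the root is
  queried after finitely many steps; hence, for a finite cluster, any finite set of pairs touching
  it is eventually queried (`eventually_subset_queried`).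

Everything here is deterministic; the probabilistic part (law of the transcript, the martingale
identity) is a sequel file.

## References

* [Hutchcroft2021] T. Hutchcroft, arXiv:2008.11197, §3, proof of Prop. 3.2 (p. 18).
* [Hutchcroft2019Locality] T. Hutchcroft, Ann. Probab. 48 (2020), arXiv:1808.08940, §3.
-/

noncomputable section

namespace Literature.Probability.Percolation

namespace FairExploration

open Classical

variable {V : Type*}

/-! ### Transcripts -/

/-- The pairs queried in a transcript. [folklore] -/
def queried (l : List (Sym2 V × Bool)) : Finset (Sym2 V) := (l.map Prod.fst).toFinset

/-- The pairs found open in a transcript. [folklore] -/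
def opened (l : List (Sym2 V × Bool)) : Finset (Sym2 V) :=
  ((l.filter fun q => q.2).map Prod.fst).toFinset

/-- The part of the cluster of the root `o` discovered by a transcript: the cluster of `o` in the
configuration of the pairs found open. [cite: Hutchcroft2021, proof of Prop. 3.2 (p. 18)] -/
def active (l : List (Sym2 V × Bool)) (o : V) : Set V := openCluster (↑(opened l) : Set (Sym2 V)) o

/-- A pair is a candidate for the next query: not yet queried, and touching the discovered part.
[cite: Hutchcroft2021, proof of Prop. 3.2 (p. 18)] -/
def IsCandidate (l : List (Sym2 V × Bool)) (o : V) (e : Sym2 V) : Prop :=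
  e ∉ queried l ∧ ∃ y ∈ active l o, y ∈ e

/-- Queried pairs of a cons. [folklore] -/
theorem mem_queried_cons {q : Sym2 V × Bool} {l : List (Sym2 V × Bool)} {e : Sym2 V} :
    e ∈ queried (q :: l) ↔ e = q.1 ∨ e ∈ queried l := by
  simp [queried]

/-- Opened pairs of a cons. [folklore] -/
theorem mem_opened_cons {q : Sym2 V × Bool} {l : List (Sym2 V × Bool)} {e : Sym2 V} :
    e ∈ opened (q :: l) ↔ (e = q.1 ∧ q.2 = true) ∨ e ∈ opened l := by
  simp only [opened, List.filter_cons]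
  split_ifs with h
  · simp [h]
  · simp only [List.mem_toFinset, List.mem_map, List.mem_filter]
    constructor
    · rintro ⟨q', hq', rfl⟩; exact Or.inr ⟨q', hq', rfl⟩
    · rintro (⟨rfl, h2⟩ | ⟨q', hq', rfl⟩)
      · exact absurd h2 h
      · exact ⟨q', hq', rfl⟩

/-- Nothing is queried in the empty transcript. [folklore] -/
@[simp] theorem queried_nil : queried ([] : List (Sym2 V × Bool)) = ∅ := by simp [queried]

/-- Nothing is opened in the empty transcript. [folklore] -/
@[simp] theorem opened_nil : opened ([] : List (Sym2 V × Bool)) = ∅ := by simp [opened]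

/-- Opened pairs are queried. [folklore] -/
theorem opened_subset_queried (l : List (Sym2 V × Bool)) : opened l ⊆ queried l := by
  intro e he
  simp only [opened, queried, List.mem_toFinset, List.mem_map, List.mem_filter] at he ⊢
  obtain ⟨q, ⟨hq, -⟩, rfl⟩ := he
  exact ⟨q, hq, rfl⟩

/-- The root is discovered. [folklore] -/
theorem root_mem_active (l : List (Sym2 V × Bool)) (o : V) : o ∈ active l o := mem_openCluster_self _ o

variable [Infinite V]

/-- **Candidates exist**: the root touches infinitely many pairs and only finitely many are queried.
[cite: Hutchcroft2021, proof of Prop. 3.2 (p. 18)] -/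
theorem exists_isCandidate (l : List (Sym2 V × Bool)) (o : V) : ∃ e, IsCandidate l o e := by
  -- an unqueried pair `{o, y}`
  have hinf : Set.Infinite (Set.range fun y : V => s(o, y)) := by
    refine Set.infinite_range_of_injective fun y y' h => ?_
    rcases Sym2.eq_iff.1 h with ⟨-, h⟩ | ⟨h1, h2⟩
    · exact h
    · rw [← h1, h2]
  obtain ⟨e, ⟨y, rfl⟩, hy⟩ := (hinf.sdiff (queried l).finite_toSet).nonempty
  exact ⟨s(o, y), fun h => hy h, o, root_mem_active l o, Sym2.mem_mk_left o y⟩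

variable (ι : Sym2 V ↪ ℕ)

/-- Some candidate has some index. [folklore] -/
theorem exists_index_isCandidate (l : List (Sym2 V × Bool)) (o : V) :
    ∃ m, ∃ e, ι e = m ∧ IsCandidate l o e := by
  obtain ⟨e, he⟩ := exists_isCandidate l o
  exact ⟨ι e, e, rfl, he⟩

/-- **The next query**: the candidate of least index. [cite: Hutchcroft2021, proof of Prop. 3.2 (p. 18)] -/
def next (l : List (Sym2 V × Bool)) (o : V) : Sym2 V :=
  Classical.choose (Nat.find_spec (exists_index_isCandidate ι l o))

/-- The next query is a candidate of least index. [folklore] -/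
theorem next_spec (l : List (Sym2 V × Bool)) (o : V) :
    IsCandidate l o (next ι l o) ∧ ∀ e, IsCandidate l o e → ι (next ι l o) ≤ ι e := by
  have hspec := Classical.choose_spec (Nat.find_spec (exists_index_isCandidate ι l o))
  refine ⟨hspec.2, fun e he => ?_⟩
  show ι (Classical.choose (Nat.find_spec (exists_index_isCandidate ι l o))) ≤ ι e
  rw [hspec.1]
  exact Nat.find_min' (exists_index_isCandidate ι l o) ⟨e, rfl, he⟩

/-- The next query is fresh. [folklore] -/
theorem next_not_mem_queried (l : List (Sym2 V × Bool)) (o : V) : next ι l o ∉ queried l :=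
  (next_spec ι l o).1.1

/-- The next query touches the discovered part. [folklore] -/
theorem next_touches_active (l : List (Sym2 V × Bool)) (o : V) : ∃ y ∈ active l o, y ∈ next ι l o :=
  (next_spec ι l o).1.2

/-- The next query has least index among the candidates. [folklore] -/
theorem index_next_le {l : List (Sym2 V × Bool)} {o : V} {e : Sym2 V} (he : IsCandidate l o e) :
    ι (next ι l o) ≤ ι e :=
  (next_spec ι l o).2 e he

/-! ### The exploration -/

/-- **The transcript after `n` steps** on the configuration `ω`, from the root `o`: query the least
candidate, record whether it is open, repeat (newest query first).
[cite: Hutchcroft2021, proof of Prop. 3.2 (p. 18)] -/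
def explore (ω : BondConfig V) (o : V) : ℕ → List (Sym2 V × Bool)
  | 0 => []
  | n + 1 => (next ι (explore ω o n) o, decide (next ι (explore ω o n) o ∈ ω)) :: explore ω o n

/-- The empty transcript. [folklore] -/
@[simp] theorem explore_zero (ω : BondConfig V) (o : V) : explore ι ω o 0 = [] := rfl

/-- One more step. [folklore] -/
theorem explore_succ (ω : BondConfig V) (o : V) (n : ℕ) :
    explore ι ω o (n + 1) =
      (next ι (explore ι ω o n) o, decide (next ι (explore ι ω o n) o ∈ ω)) :: explore ι ω o n := rfl

/-- The queried set grows by the next query. [folklore] -/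
theorem queried_explore_succ (ω : BondConfig V) (o : V) (n : ℕ) :
    queried (explore ι ω o (n + 1)) = insert (next ι (explore ι ω o n) o) (queried (explore ι ω o n)) := by
  ext e; rw [explore_succ, mem_queried_cons, Finset.mem_insert]

/-- Length of the transcript. [folklore] -/
theorem length_explore (ω : BondConfig V) (o : V) (n : ℕ) : (explore ι ω o n).length = n := by
  induction n with
  | zero => rfl
  | succ n ih => rw [explore_succ, List.length_cons, ih]

/-- **Answers are recorded**: a queried pair is recorded open iff it is open. [folklore] -/
theorem mem_opened_explore_iff (ω : BondConfig V) (o : V) (n : ℕ) (e : Sym2 V) :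
    e ∈ opened (explore ι ω o n) ↔ e ∈ queried (explore ι ω o n) ∧ e ∈ ω := by
  induction n with
  | zero => simp
  | succ n ih =>
    rw [explore_succ, mem_opened_cons, mem_queried_cons]
    simp only [decide_eq_true_eq]
    constructor
    · rintro (⟨rfl, h⟩ | h)
      · exact ⟨Or.inl rfl, h⟩
      · exact ⟨Or.inr (ih.1 h).1, (ih.1 h).2⟩
    · rintro ⟨rfl | h, hω⟩
      · exact Or.inl ⟨rfl, hω⟩
      · exact Or.inr (ih.2 ⟨h, hω⟩)

/-- The queried sets increase. [folklore] -/
theorem queried_explore_mono (ω : BondConfig V) (o : V) : Monotone fun n => queried (explore ι ω o n) := by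
  refine monotone_nat_of_le_succ fun n => ?_
  show queried (explore ι ω o n) ⊆ queried (explore ι ω o (n + 1))
  rw [queried_explore_succ]
  exact Finset.subset_insert _ _

/-- The opened sets increase. [folklore] -/
theorem opened_explore_mono (ω : BondConfig V) (o : V) : Monotone fun n => opened (explore ι ω o n) := by
  intro m n hmn e he
  rw [mem_opened_explore_iff] at he ⊢
  exact ⟨queried_explore_mono ι ω o hmn he.1, he.2⟩

/-- The discovered parts increase. [folklore] -/
theorem active_explore_mono (ω : BondConfig V) (o : V) : Monotone fun n => active (explore ι ω o n) o := by
  intro m n hmn y hy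
  exact hy.mono (openGraph_mono (Finset.coe_subset.2 (opened_explore_mono ι ω o hmn)))

/-- The discovered part lies in the open cluster of the root. [folklore] -/
theorem active_explore_subset (ω : BondConfig V) (o : V) (n : ℕ) :
    active (explore ι ω o n) o ⊆ openCluster ω o := by
  intro y hy
  refine hy.mono (openGraph_mono fun e he => ?_)
  exact ((mem_opened_explore_iff ι ω o n e).1 (Finset.mem_coe.1 he)).2

/-- **Queried pairs touch the cluster of the root.** [cite: Hutchcroft2021, proof of Prop. 3.2 ("{E_i} = E(K)")] -/
theorem exists_mem_openCluster_of_mem_queried (ω : BondConfig V) (o : V) (n : ℕ) {e : Sym2 V}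
    (he : e ∈ queried (explore ι ω o n)) : ∃ y ∈ openCluster ω o, y ∈ e := by
  induction n with
  | zero => simp at he
  | succ n ih =>
    rw [queried_explore_succ, Finset.mem_insert] at he
    rcases he with rfl | he
    · obtain ⟨y, hy, hye⟩ := next_touches_active ι (explore ι ω o n) o
      exact ⟨y, active_explore_subset ι ω o n hy, hye⟩
    · exact ih he

/-- **Determinism**: configurations agreeing on the pairs queried by `ω` in `n` steps have the same
transcript. [cite: Hutchcroft2021, proof of Prop. 3.2 (p. 18)] -/
theorem explore_congr {ω ω' : BondConfig V} {o : V} {n : ℕ}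
    (h : ∀ e ∈ queried (explore ι ω o n), (e ∈ ω ↔ e ∈ ω')) : explore ι ω' o n = explore ι ω o n := by
  induction n with
  | zero => rfl
  | succ n ih =>
    have h' : ∀ e ∈ queried (explore ι ω o n), (e ∈ ω ↔ e ∈ ω') := fun e he =>
      h e (queried_explore_mono ι ω o (Nat.le_succ n) he)
    rw [explore_succ, explore_succ, ih h']
    have hn : (next ι (explore ι ω o n) o ∈ ω ↔ next ι (explore ι ω o n) o ∈ ω') :=
      h _ (by rw [queried_explore_succ]; exact Finset.mem_insert_self _ _)
    simp only [hn]

/-- **The transcript event is a cylinder** on the queried pairs: `{ω' | explore ω' = explore ω} =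
{ω' | ω' agrees with the recorded answers on the queried pairs}`. [cite: Hutchcroft2021, proof of Prop. 3.2 (p. 18)] -/
theorem setOf_explore_eq (ω : BondConfig V) (o : V) (n : ℕ) :
    {ω' : BondConfig V | explore ι ω' o n = explore ι ω o n} =
      {ω' | ∀ e ∈ queried (explore ι ω o n), (e ∈ ω' ↔ e ∈ opened (explore ι ω o n))} := by
  ext ω'
  simp only [Set.mem_setOf_eq]
  constructor
  · intro h e he
    rw [← h] at he ⊢
    rw [mem_opened_explore_iff]
    exact ⟨fun hω' => ⟨he, hω'⟩, fun h => h.2⟩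
  · intro h
    refine explore_congr ι fun e he => ?_
    rw [h e he, mem_opened_explore_iff]
    exact ⟨fun hω => ⟨he, hω⟩, fun h => h.2⟩

/-- The transcript event is determined by the queried pairs. [folklore] -/
theorem determinedBy_setOf_explore (ω : BondConfig V) (o : V) (n : ℕ) :
    DeterminedBy {ω' : BondConfig V | explore ι ω' o n = explore ι ω o n} ↑(queried (explore ι ω o n)) := by
  rw [setOf_explore_eq, determinedBy_iff]
  intro ω₁ ω₂ h12
  simp only [Set.mem_setOf_eq]
  refine forall₂_congr fun e he => ?_
  have := Set.ext_iff.1 h12 e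
  simp only [Set.mem_inter_iff, Finset.mem_coe, he, and_true] at this
  rw [this]

/-! ### Fairness -/

/-- **A candidate is queried within `ι e + 1` further steps**: while `e` is an unqueried candidate,
each step queries a new pair of index at most `ι e`. [cite: Hutchcroft2021, proof of Prop. 3.2 (p. 18)] -/
theorem mem_queried_of_isCandidate (ω : BondConfig V) (o : V) {N : ℕ} {e : Sym2 V}
    (he : IsCandidate (explore ι ω o N) o e) : e ∈ queried (explore ι ω o (N + (ι e + 1))) := by
  by_contra hcon
  -- for `k ≤ ι e + 1`, the `k` pairs queried after time `N` have distinct indices `≤ ι e`, none `= ι e`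
  have hstay : ∀ k, k ≤ ι e + 1 → e ∉ queried (explore ι ω o (N + k)) := fun k hk h =>
    hcon (queried_explore_mono ι ω o (by omega) h)
  have hcand : ∀ k, k ≤ ι e + 1 → IsCandidate (explore ι ω o (N + k)) o e := fun k hk =>
    ⟨hstay k hk, by
      obtain ⟨y, hy, hye⟩ := he.2
      exact ⟨y, active_explore_mono ι ω o (Nat.le_add_right N k) hy, hye⟩⟩
  -- the injection `k ↦ ι (query at time N + k)` into `{0, …, ι e - 1}`
  set f : Fin (ι e + 1) → ℕ := fun k => ι (next ι (explore ι ω o (N + k)) o) with hf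
  have hf_lt : ∀ k, f k < ι e := by
    intro k
    have h1 : f k ≤ ι e := index_next_le ι (hcand k (by omega))
    have h2 : f k ≠ ι e := by
      intro heq
      have : next ι (explore ι ω o (N + k)) o = e := ι.injective heq
      apply hstay (k + 1) (by omega)
      rw [← add_assoc, queried_explore_succ]
      exact Finset.mem_insert.2 (Or.inl this.symm)
    omega
  have hf_inj : Function.Injective f := by
    intro k k' hkk'
    have hedge : next ι (explore ι ω o (N + k)) o = next ι (explore ι ω o (N + k')) o := ι.injective hkk'
    by_contra hne
    rcases lt_or_gt_of_ne (Fin.val_ne_of_ne hne) with hlt | hlt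
    · -- the query at time `N + k` is queried by time `N + k + 1 ≤ N + k'`, so it is not fresh at `N + k'`
      have hmem : next ι (explore ι ω o (N + k)) o ∈ queried (explore ι ω o (N + k')) := by
        have h1 : next ι (explore ι ω o (N + k)) o ∈ queried (explore ι ω o (N + k + 1)) := by
          rw [queried_explore_succ]; exact Finset.mem_insert_self _ _
        exact queried_explore_mono ι ω o (show N + k + 1 ≤ N + k' by omega) h1
      rw [hedge] at hmem
      exact next_not_mem_queried ι _ o hmem
    · have hmem : next ι (explore ι ω o (N + k')) o ∈ queried (explore ι ω o (N + k)) := by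
        have h1 : next ι (explore ι ω o (N + k')) o ∈ queried (explore ι ω o (N + k' + 1)) := by
          rw [queried_explore_succ]; exact Finset.mem_insert_self _ _
        exact queried_explore_mono ι ω o (show N + k' + 1 ≤ N + k by omega) h1
      rw [← hedge] at hmem
      exact next_not_mem_queried ι _ o hmem
  -- `ι e + 1` distinct naturals `< ι e`: impossible
  have hcard := Finset.card_le_card (show Finset.univ.image f ⊆ Finset.range (ι e) from
    fun m hm => by
      obtain ⟨k, -, rfl⟩ := Finset.mem_image.1 hm
      exact Finset.mem_range.2 (hf_lt k))
  rw [Finset.card_image_of_injective _ hf_inj, Finset.card_univ, Fintype.card_fin, Finset.card_range] at hcard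
  omega

/-- **Every vertex of the cluster is eventually discovered.** [cite: Hutchcroft2021, proof of Prop. 3.2 ("{E_i} = E(K)")] -/
theorem exists_mem_active_of_mem_openCluster (ω : BondConfig V) (o : V) {y : V} (hy : y ∈ openCluster ω o) :
    ∃ N, y ∈ active (explore ι ω o N) o := by
  obtain ⟨p⟩ := hy
  -- induction along the walk
  suffices h : ∀ (u : V) (q : (openGraph ω).Walk u y), (∃ N, u ∈ active (explore ι ω o N) o) →
      ∃ N, y ∈ active (explore ι ω o N) o from h o p ⟨0, root_mem_active _ o⟩
  clear p
  intro u q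
  induction q with
  | nil => exact id
  | @cons u v w hadj q ih =>
    rintro ⟨N, hu⟩
    apply ih
    obtain ⟨he, huv⟩ := (openGraph_adj ω u v).1 hadj
    -- the pair `{u,v}` is queried at some time `N' ≥ N`, and is then recorded open
    have hq : ∃ N', N ≤ N' ∧ s(u, v) ∈ queried (explore ι ω o N') := by
      by_cases hmem : s(u, v) ∈ queried (explore ι ω o N)
      · exact ⟨N, le_rfl, hmem⟩
      · exact ⟨N + (ι s(u, v) + 1), Nat.le_add_right _ _,
          mem_queried_of_isCandidate ι ω o ⟨hmem, u, hu, Sym2.mem_mk_left u v⟩⟩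
    obtain ⟨N', hNN', hmem⟩ := hq
    refine ⟨N', ?_⟩
    have hopen : s(u, v) ∈ opened (explore ι ω o N') := (mem_opened_explore_iff ι ω o N' _).2 ⟨hmem, he⟩
    have hu' : u ∈ active (explore ι ω o N') o := active_explore_mono ι ω o hNN' hu
    exact hu'.trans (SimpleGraph.Adj.reachable ((openGraph_adj _ u v).2 ⟨Finset.mem_coe.2 hopen, huv⟩))

/-- **Fairness**: every pair touching the open cluster of the root is eventually queried.
[cite: Hutchcroft2021, proof of Prop. 3.2 ("{E_i : 1 ≤ i ≤ T} = E(K)")] -/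
theorem exists_mem_queried_of_touches (ω : BondConfig V) (o : V) {e : Sym2 V}
    (he : ∃ y ∈ openCluster ω o, y ∈ e) : ∃ N, e ∈ queried (explore ι ω o N) := by
  obtain ⟨y, hy, hye⟩ := he
  obtain ⟨N, hN⟩ := exists_mem_active_of_mem_openCluster ι ω o hy
  by_cases hmem : e ∈ queried (explore ι ω o N)
  · exact ⟨N, hmem⟩
  · exact ⟨N + (ι e + 1), mem_queried_of_isCandidate ι ω o ⟨hmem, y, hN, hye⟩⟩

/-- **A finite set of pairs touching the cluster is eventually queried, and stays queried.** [folklore] -/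
theorem eventually_subset_queried (ω : BondConfig V) (o : V) {R : Finset (Sym2 V)}
    (hR : ∀ e ∈ R, ∃ y ∈ openCluster ω o, y ∈ e) :
    ∃ N, ∀ n, N ≤ n → R ⊆ queried (explore ι ω o n) := by
  choose! T hT using fun e (he : e ∈ R) => exists_mem_queried_of_touches ι ω o (hR e he)
  refine ⟨R.sup T, fun n hn e he => ?_⟩
  exact queried_explore_mono ι ω o (le_trans (Finset.le_sup he) hn) (hT e he)

end FairExploration

end Literature.Probability.Percolation

end
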